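import Summits.QuantumFields.QCD.Theses.SmallBetaInfraredSplit

/-!
# Route `SmallBetaInfraredSplit` (sub QCD) — the `Assembly` item, PROVED (real arithmetic with the printed margin)

Ideator seat `ym-idea-2` g4 (2026-08-28), LINE 6 onto the LADDER-YM rung Q1 leaf `Summit.Ventures.YMGap.Conjectures.SalmhoferSeilerSmallBeta`
(a RECORD rung: chiral long-range order of U(N) + massless staggered fermions at small plaquette coupling; NOT the mass gap, NOT a continuum
statement; nothing about the summit `QCD` is proved here).

`Assembly` := IRBoundSmallBeta → NeighbourFloorSmallBeta → TwoPointKernelStructure → FourierSumRule → MarginLargeTorus → ⟨leaf body⟩, where the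
leaf body is `SalmhoferSeilerSmallBeta` with `ssChiralOrder`/`ssTwoPoint` unfolded (`Iff.rfl`).  PROOF: feed the kernel structure (S0) and the
infrared bound with constant `B = (2N)²(1/N + C₁β)` (K1) into the kernel-abstract Fourier sum rule (S1): nn-average ≤ 4ν·X + 2B·S_Λ; compare with
the Schwinger–Dyson floor nn-average ≥ (2N)²(1/K(N) − C₂β) (K2); the margin μ ≤ 1/K(N) − 2S_Λ/N, S_Λ ≤ 1 (S2) then gives
X ≥ (2N)²μ/(8ν) once β ≤ μ/(2(C₂ + 2C₁ + 1)).  Witnesses: β₀ := min β₁ (min β₂ (μ/(2(C₂+2C₁+1)))), c := (2N)²μ/(8ν), L₀ := max (max L₁ L₂) 4.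
[SalmhoferSeiler1991, (4.40)–(4.43)]
-/

set_option autoImplicit false

namespace Summit.QuantumFields.QCD.Theorems.SmallBetaInfraredSplit

open Summit.QuantumFields.QCD.Theses.SmallBetaInfraredSplit

/-- The route's `Assembly` item BY NAME. -/
theorem assembly_proof : Summit.QuantumFields.QCD.Theses.SmallBetaInfraredSplit.Assembly := by
  intro h₁ h₂ h₃ h₄ h₅ N ν hN1 hN4 hν
  obtain ⟨β₁, hβ₁, C₃, hC₃, hIR⟩ := h₁ N ν hN1 hN4 hν
  obtain ⟨β₂, hβ₂, C₄, hC₄, L₀, hNN⟩ := h₂ N ν hN1 hN4 hν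
  obtain ⟨μ, hμ, L₁, hM⟩ := h₅ N ν hN1 hN4 hν
  have hN : (0 : ℝ) < N := Nat.cast_pos.mpr (by omega)
  have hνpos : (0 : ℝ) < ν := Nat.cast_pos.mpr (by omega)
  have hP : (0 : ℝ) < (2 * N : ℝ) ^ 2 := by positivity
  have hDpos : (0 : ℝ) < C₄ + 2 * C₃ + 1 := by positivity
  refine ⟨min β₁ (min β₂ (μ / (2 * (C₄ + 2 * C₃ + 1)))), lt_min hβ₁ (lt_min hβ₂ (by positivity)),
    (2 * N : ℝ) ^ 2 * μ / (8 * ν), by positivity, max (max L₀ L₁) 4, ?_⟩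
  intro β hβ0 hβ L _ hE hL
  have hβ1 : β < β₁ := lt_of_lt_of_le hβ (min_le_left _ _)
  have hβ2 : β < β₂ := lt_of_lt_of_le hβ ((min_le_right _ _).trans (min_le_left _ _))
  have hβμ : β ≤ μ / (2 * (C₄ + 2 * C₃ + 1)) :=
    (lt_of_lt_of_le hβ ((min_le_right _ _).trans (min_le_right _ _))).le
  have hL4 : 4 ≤ L := le_trans (le_max_right _ _) hL
  have hL0 : L₀ ≤ L := le_trans ((le_max_left _ _).trans (le_max_left _ _)) hL
  have hL1' : L₁ ≤ L := le_trans ((le_max_right _ _).trans (le_max_left _ _)) hL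
  have hν1 : 1 ≤ ν := by omega
  have h2L : 2 ∣ L := even_iff_two_dvd.mp hE
  have A := hIR β hβ0 hβ1 L hE hL4
  have Bnn := hNN β hβ0 hβ2 L hE hL0
  obtain ⟨hsym, htr, hpar⟩ := h₃ N ν hN1 hν1 L h2L β
  have S := h₄ ν hν1 L h2L hL4 _ hsym htr hpar ((2 * N : ℝ) ^ 2 * (1 / N + C₃ * β)) A
  beta_reduce at S
  obtain ⟨hm, hS1⟩ := hM L hE hL1'
  have h2 := le_trans Bnn S
  have hβD : β * (C₄ + 2 * C₃ + 1) ≤ μ / 2 := by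
    calc β * (C₄ + 2 * C₃ + 1) ≤ μ / (2 * (C₄ + 2 * C₃ + 1)) * (C₄ + 2 * C₃ + 1) :=
          mul_le_mul_of_nonneg_right hβμ hDpos.le
      _ = μ / 2 := by field_simp
  have h1 : 2 * C₃ * β * Literature.MathematicalPhysics.StatisticalMechanics.ComplexSpin.latticeS ν L
      ≤ 2 * C₃ * β := by
    have h0 : 0 ≤ 2 * C₃ * β := by positivity
    simpa using mul_le_mul_of_nonneg_left hS1 h0
  have e1 := mul_le_mul_of_nonneg_left hm hP.le
  have e2 := mul_le_mul_of_nonneg_left h1 hP.le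
  have e3 := mul_le_mul_of_nonneg_left hβD hP.le
  have e4 : 0 ≤ (2 * N : ℝ) ^ 2 * β := by positivity
  set P : ℝ := (2 * N : ℝ) ^ 2 with hPdef
  set X : ℝ := ((L : ℝ) ^ ν)⁻¹ * ∑ x : Literature.Probability.LatticeModels.TorusSite ν L, (MeasureTheory.integral (Literature.MathematicalPhysics.QuantumFieldTheory.wilsonWeight (d := ν) (L := L) (Literature.MathematicalPhysics.QuantumLattice.unitaryFundamentalRep (Fin N) ℂ) β) (fun U => (Matrix.det (Literature.MathematicalPhysics.QuantumLattice.staggeredDirac (Literature.MathematicalPhysics.QuantumLattice.unitaryFundamentalRep (Fin N) ℂ) U 0)).re * (let G := (Literature.MathematicalPhysics.QuantumLattice.staggeredDirac (Literature.MathematicalPhysics.QuantumLattice.unitaryFundamentalRep (Fin N) ℂ) U 0)⁻¹; ((∑ a : Fin N, G ((0 : Literature.Probability.LatticeModels.TorusSite ν L), a) ((0 : Literature.Probability.LatticeModels.TorusSite ν L), a)) * (∑ b : Fin N, G (x, b) (x, b)) - ∑ a : Fin N, ∑ b : Fin N, G ((0 : Literature.Probability.LatticeModels.TorusSite ν L),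 a) (x, b) * G (x, b) ((0 : Literature.Probability.LatticeModels.TorusSite ν L), a)).re)) / MeasureTheory.integral (Literature.MathematicalPhysics.QuantumFieldTheory.wilsonWeight (d := ν) (L := L) (Literature.MathematicalPhysics.QuantumLattice.unitaryFundamentalRep (Fin N) ℂ) β) (fun U => (Matrix.det (Literature.MathematicalPhysics.QuantumLattice.staggeredDirac (Literature.MathematicalPhysics.QuantumLattice.unitaryFundamentalRep (Fin N) ℂ) U 0)).re)) with hXdef
  set SL : ℝ := Literature.MathematicalPhysics.StatisticalMechanics.ComplexSpin.latticeS ν L with hSLdef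
  set Kinv : ℝ := 1 / Literature.MathematicalPhysics.StatisticalMechanics.ComplexSpin.sdK N
    (Literature.MathematicalPhysics.StatisticalMechanics.ComplexSpin.uNLogCoeff N) with hKdef
  have e1' : P * μ ≤ P * Kinv - 2 * (P * (1 / (N : ℝ)) * SL) := by
    have : P * (Kinv - 2 * SL / (N : ℝ)) = P * Kinv - 2 * (P * (1 / (N : ℝ)) * SL) := by ring
    rw [← this]; exact e1
  have h2' : P * Kinv - P * C₄ * β ≤ 4 * ν * X + 2 * (P * (1 / (N : ℝ)) * SL) + 2 * P * C₃ * β * SL := by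
    have hl : P * (Kinv - C₄ * β) = P * Kinv - P * C₄ * β := by ring
    have hr : 4 * (ν : ℝ) * X + 2 * (P * (1 / (N : ℝ) + C₃ * β)) * SL =
        4 * ν * X + 2 * (P * (1 / (N : ℝ)) * SL) + 2 * P * C₃ * β * SL := by ring
    rw [← hl, ← hr]; exact h2
  have f1 : P * μ ≤ 4 * ν * X + 2 * P * C₃ * β * SL + P * C₄ * β := by linarith [h2', e1']
  have e2' : 2 * P * C₃ * β * SL ≤ 2 * P * C₃ * β := by
    have hl : P * (2 * C₃ * β * SL) = 2 * P * C₃ * β * SL := by ring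
    have hr : P * (2 * C₃ * β) = 2 * P * C₃ * β := by ring
    rw [← hl, ← hr]; exact e2
  have f2 : P * μ ≤ 4 * ν * X + 2 * P * C₃ * β + P * C₄ * β := by linarith [f1, e2']
  have e3' : P * C₄ * β + 2 * P * C₃ * β + P * β ≤ P * (μ / 2) := by
    have hl : P * (β * (C₄ + 2 * C₃ + 1)) = P * C₄ * β + 2 * P * C₃ * β + P * β := by ring
    rw [← hl]; exact e3
  have h3 : P * (μ / 2) ≤ 4 * ν * X := by linarith [f2, e3', e4]
  rw [div_le_iff₀ (by positivity)]
  have : P * (μ / 2) * 2 = P * μ := by ring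
  have h4 : 4 * (ν : ℝ) * X * 2 = X * (8 * ν) := by ring
  nlinarith [h3, this, h4]


end Summit.QuantumFields.QCD.Theorems.SmallBetaInfraredSplit
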